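import Summits.QuantumFields.BalabanUV.Beta.EriceFlowEnclosureB12AsPrintedPointwiseFadingLimitCarrier
import Summits.QuantumFields.BalabanUV.Beta.EriceFlowEnclosureB12AsPrintedPointwiseFadingLimitEnd
import Summits.QuantumFields.BalabanUV.Gaps.EndRunwiseCone
import Summits.QuantumFields.BalabanUV.Gaps.EndSurvivorCensus

/-!
# Beta / EriceFlowEnclosureB12AsPrintedPointwiseFadingRunRows — WHAT (0.31) FORCES, part 12: THE DECIDING CRUX'S RUN ROWS.
# The last conjunct of the DECIDING crux K1⁸ `StabilityBRunRowsAtRecordR13SepCoPH` (stmt-QuantumFields-26907, route `BalabanUVNodes` rev 27) is the ROWS text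
# `RunRowsCont13 F θ = ∃ b r γ₀ M, 0 < γ₀ ∧ (i) run-wise constant remainder |β_θ k (prefix) − b k| ≤ r ∧ (iv) run-wise partial-sum floor −M ∧ (C) run-wise survivor
# continuity` («b r γ₀ M ∃-side; NO drift, NO anchor, NO cap, NO ceiling match», `…Theorems.BalabanUVNodesK1R8RowsDefs`).  THIS FILE supplies that ∃-shape, spelled
# INLINE over an ABSTRACT `β : FlowStep.HBeta`, from the β-flow team's letters — ANCHOR-FREE, JET-FREE, DRIFT-FREE, CAP-FREE:
#  (i) from node U2's MODULI ALONE at EVERY level 0 < γ₀ ≤ γ with `b k := β_{k+1}(γ₀,…,γ₀)` (the β's OWN constant-history values) and radius `Cγ₀∕(1−θ)` PROPORTIONAL TO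
#      THE LEVEL (§1); with NE4 the constant sequence `b ≡ b⋆` (§1); (C) from the moduli ALONE at every level (§2); (iv) from (α) the moduli + a displayed family of
#      (0.31)-runs, NE4-FREE, (β) the moduli + NE4 on every level `2Cγ₀ ≤ b⋆(1−θ)` with the LEVEL-FREE `M = c∕(1−θ)²`, (γ) node U2's eventual letter (§3);
#  THE ROWS TRIPLE (§4) and, on the as-printed carrier, **[I] THEOREM 2 AS TYPED + `hrg` + node U2's moduli ⟹ the rows ∃-shape for `S.β`, NE4-FREE** (§5).
# (β-flow team, prover 2 = lower ∕ positivity side, unit `b2b-balaban-beta-bflow-p2`, gen 50; ROW AP-I × K1⁸'s rows currency; the per-tuple junction into DEF-1's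
# `RunRowsCont13 F θ` is the YangMills-side companion `…Theorems.BalabanUVNodesK1RunRowsOfU2Letters`)

HONEST FRAMING (page 1 of everything the β sub-cell writes): discharging `BetaPertH` makes Bałaban's UV stability UNCONDITIONAL — a
real constructive-QFT result; it is NOT the continuum limit and NOT the Clay problem.  HONEST DEPENDENCY (cell reorg 2026-08-19,
verbatim): «continuum YM on T⁴ ⇐ BetaPertH ∧ nine spine estimates (0/9 proved); BetaPertH ⇐ (D1) ∧ (D4) ∧ CAP+tail; G-an2-4 gates
asym, D1 and NE2/3/4.»  THIS MODULE DISCHARGES NOTHING: it is [folklore] finite-sum bookkeeping BY NAME for an ABSTRACT `β : FlowStep.HBeta` under node U2's HYPOTHESIS SHAPES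
`T4CouplingMatching.HistLipschitz ∕ FadingMemory ∕ ScaleShiftRate ∕ EventualLowerH` (NONE printed — [Balaban1987RG1] = T. Bałaban, Commun. Math. Phys. **109** (1987) p. 298 states
the history dependence only, p. 264 *"We will investigate other properties in a separate paper"*; GAPS G-t4-U2-1 ∕ G-t4-U2-2), a DISPLAYED family of (0.31)-runs, and (§5) the
statement-exact typing `B12BetaAsPrinted.Theorem2Statement` (STATED WITHOUT PROOF in print, p. 259 — a HYPOTHESIS) under prover 1's letter `hrg`.  Consumed BY NAME, nothing restated or
modified: parts 10∕11 of this series (`betaAvgAFH_of_runs_fadingMemory`, `runs_of_theorem2`, `abs_sub_const_le_of_mem_box`, `abs_const_sub_betaInf_le`, `abs_beta_sub_bstar_le`,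
`exists_bstar`, `betaAvgAFH_bstar`, `bstar_pos_of_typedTheorem2`), node U2's `T4BetaStationary.betaContH_of_histLipschitz` ∕ `T4CouplingMatching.prefixOf_mem_box`, crew CAP's
`AveragedAFCarrier.BetaAvgAFH.partialSums`, pub-balaban-gaps' `Gaps.EndRunwiseCone.runwisePS_of_betaPartialSumsLowerH` ∕ `Gaps.EndSurvivorCensus.survCont_of_betaContH`.  The row
SHAPES are those of DEF-1's `RunConstRemainder` ∕ run-wise (PS) ∕ `SurvCont` (`…Theorems.BalabanUVNodesK2NamedJetsRunRemAt` §1), spelled INLINE here (no YangMills import, no `def`).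
NO stub of K1 v7ᴿ is proved: the rows AT THE WITNESS for Bałaban's β of the record are [Balaban1988RG2Cluster] (2.41)-class content (instance 0∕1).  Nothing is asserted about
Bałaban's β-functions (1.22), their sign, floor, moduli or scale-shift rate.

WHAT THIS FILE PROVES (0 sorry, 0 def):
§1 **`runRem_constHist_of_moduli`** ((i) at every level, `b k = β_{k+1}(γ₀,…,γ₀)`, `r = Cγ₀∕(1−θ)`), **`runRem_bstar_of_moduli_NE4`** ((i) with `b ≡ b⋆`, `r = 2Cγ₀∕(1−θ) + c∕(1−θ)`),
   **`oneLoopDrift_constHist_of_NE4`** (under NE4 the constant-history values ARE a drifting one-loop sequence: `OneLoopDrift (betaInf β (γ₀,γ₀,…)) (c∕(1−θ)²) (k ↦ β_{k+1}(γ₀,…,γ₀))` —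
   so DEF-1's ★ road applies to them with the cap `Cγ₀∕(1−θ) ≤ betaInf β (γ₀,…)`, free on small levels when `b⋆ > 0`).
§2 `betaContH_of_moduli_le`, **`survCont_of_moduli`** ((C) at every level from `HistLipschitz` alone).
§3 **`betaPartialSumsLowerH_of_runs_moduli`** ∕ `runPS_of_runs_moduli` ((α), NE4-free), **`betaPartialSumsLowerH_of_moduli_NE4`** ∕ `runPS_of_moduli_NE4` ((β), `M = c∕(1−θ)²` on every
   level `2Cγ₀ ≤ b⋆(1−θ)`), **`betaPartialSumsLowerH_of_eventualLowerH`** ((γ), `M = k₀B`).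
§4 **`rowsTriple_of_runs_moduli`** (moduli + (0.31)-runs at slope s > 0 ⟹ the rows ∃-shape, NE4-free), **`rows_at_level_of_moduli_NE4`** (the three rows at EVERY small level with `b ≡ b⋆`),
   **`rowsTriple_of_moduli_NE4_bstar_pos`**; §4′ **`absBox_of_moduli_NE4`** (the 3ᴬ′-class SIGN-FREE |β| box `BetaLowerH (−β′) γ₀ β ∧ BetaUpperH β′ γ₀ β`, `β′ = |b⋆| + 2Cγ₀∕(1−θ) + c∕(1−θ)`, at
   every level — the letter shape of K0⁷'s stub 3ᴬ′ and the cheapest supplier of row (i)), **`endpointExistence_of_moduli_NE4`** (END for ANY forward-generated construction currying β, by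
   pub-balaban-gaps' `endpointExistence_of_runwisePS`: (C) + (U) + run-wise (PS), all three from the letters on a level with `2Cγ₀ ≤ b⋆(1−θ)`).
§5 **`rowsTriple_of_typedTheorem2_fadingMemory`** ([I] Thm 2 AS TYPED + `hrg` + moduli ⟹ rows ∃-shape for `S.β` inside ]0, γ_U], NE4-FREE), **`rowsTriple_of_typedTheorem2_NE4`** (with NE4:
   the same with the CONSTANT remainder sequence `b ≡ b⋆ > 0`).
NOT CLAIMED: any row for Bałaban's β; which reading print intends; the K1 v7ᴿ stubs; K0⁷ ∕ K1⁸ ∕ K3⁷; Theorem 2; `BetaPertH`; continuum; Clay.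
-/

namespace Summit.QuantumFields.BalabanUV.Beta.EriceFlowEnclosureB12AsPrintedPointwiseFadingRunRows

open Finset
open Literature.MathematicalPhysics.QuantumFieldTheory.Balaban1983to89
open Literature.MathematicalPhysics.QuantumFieldTheory.Balaban1983to89.B12BetaAsPrinted
open Literature.MathematicalPhysics.QuantumFieldTheory.Balaban1983to89.FlowStep (HBeta prefixOf Box mem_box box_mono RGEqH BetaContH BetaLowerH BetaUpperH clampPrefix Y)
open Literature.MathematicalPhysics.QuantumFieldTheory.Balaban1983to89.DagBinding (EndpointExistence ForwardGenerated)
open Literature.MathematicalPhysics.QuantumFieldTheory.Balaban1983to89.FlowStepRuns (BetaPartialSumsLowerH)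
open Literature.MathematicalPhysics.QuantumFieldTheory.Balaban1983to89.T4CouplingMatching (HistLipschitz FadingMemory ScaleShiftRate EventualLowerH
  prefixOf_mem_box)
open Literature.MathematicalPhysics.QuantumFieldTheory.Balaban1983to89.T4BetaStationary (betaInf betaContH_of_histLipschitz constant_nonneg_of_scaleShiftRate)
open Literature.MathematicalPhysics.QuantumFieldTheory.Balaban1983to89.Beta.AveragedAFCarrier (BetaAvgAFH)
open Literature.MathematicalPhysics.QuantumFieldTheory.Balaban1983to89.Beta.Drift (OneLoopDrift)
open Summit.QuantumFields.BalabanUV.Gaps.EndRunwiseShooting (endpointExistence_of_runwisePS)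
open Summit.QuantumFields.BalabanUV.Gaps.EndRunwiseCone (runwisePS_of_betaPartialSumsLowerH)
open Summit.QuantumFields.BalabanUV.Gaps.EndSurvivorCensus (survCont_of_betaContH)
open Summit.QuantumFields.BalabanUV.Beta.EriceFlowEnclosureB12AsPrintedPointwiseFadingDrift (betaAvgAFH_of_runs_fadingMemory runs_of_theorem2)
open Summit.QuantumFields.BalabanUV.Beta.EriceFlowEnclosureB12AsPrintedPointwiseFadingLimit (abs_sub_const_le_of_mem_box abs_const_sub_betaInf_le
  abs_beta_sub_bstar_le exists_bstar)
open Summit.QuantumFields.BalabanUV.Beta.EriceFlowEnclosureB12AsPrintedPointwiseFadingLimitCarrier (betaAvgAFH_bstar)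
open Summit.QuantumFields.BalabanUV.Beta.EriceFlowEnclosureB12AsPrintedPointwiseFadingLimitEnd (bstar_pos_of_typedTheorem2)

noncomputable section

section Generic

variable {β : HBeta} {γ C c θ : ℝ} {Λ : ℕ → ℕ → ℝ}

/-! ## §1 Row (i): the run-wise constant remainder, anchor-free — the β's own constant-history values ∕ the one number `b⋆` as remainder sequence -/

/-- **ROW (i) FROM node U2's MODULI ALONE, AT EVERY LEVEL, RADIUS PROPORTIONAL TO THE LEVEL.**  Under `HistLipschitz Λ γ β` + `FadingMemory C θ Λ` (0 ≤ θ < 1, 0 ≤ C) and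
`0 < γ₀ ≤ γ`: along EVERY solution of (0.20) up to depth `n` staying in ]0, γ₀] and every `k ≤ n`, `|β_{k+1}(g_0,…,g_k) − β_{k+1}(γ₀,…,γ₀)| ≤ Cγ₀∕(1−θ)` — DEF-1's
`RunConstRemainder β (k ↦ β_{k+1}(γ₀,…,γ₀)) (Cγ₀∕(1−θ)) γ₀` spelled inline: the remainder sequence is the β's OWN constant-history values (no anchor, no named jets) and the radius
SHRINKS with the level (part 11 `abs_sub_const_le_of_mem_box` on the run's prefixes; the RG equation is not used). [cite: Balaban1987RG1, Thm 3 p.264 with (1.22) p.264 and §5 p.298] -/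
theorem runRem_constHist_of_moduli (hL : HistLipschitz Λ γ β) (hΛ : FadingMemory C θ Λ) (hθ0 : 0 ≤ θ) (hθ1 : θ < 1) (hC : 0 ≤ C)
    {γ₀ : ℝ} (hγ₀ : 0 < γ₀) (hγ₀γ : γ₀ ≤ γ) :
    ∀ (n : ℕ) (gs : ℕ → ℝ), RGEqH n β gs → Step.InInterval γ₀ n gs →
      ∀ k, k ≤ n → |β k (prefixOf gs k) - β k (fun _ : Fin (k + 1) => γ₀)| ≤ C * γ₀ / (1 - θ) :=
  fun _ _ _ hI _ hk => abs_sub_const_le_of_mem_box hL hΛ hθ0 hθ1 hC hγ₀ hγ₀γ (prefixOf_mem_box hk hI)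

/-- **ROW (i) WITH THE CONSTANT REMAINDER SEQUENCE `b ≡ b⋆`.**  Under the moduli + NE4 `ScaleShiftRate c θ γ β` and part 11's asymptotic constant `b⋆` (its displayed property `hb`):
along every in-window run of level `0 < γ₀ ≤ γ`, `|β_{k+1}(g_0,…,g_k) − b⋆| ≤ 2Cγ₀∕(1−θ) + c∕(1−θ)` for every `k ≤ n` (part 11's sandwich `abs_beta_sub_bstar_le` with `θ^k ≤ 1`) —
`RunConstRemainder β (fun _ ↦ b⋆) (2Cγ₀∕(1−θ) + c∕(1−θ)) γ₀` spelled inline. [cite: Balaban1987RG1, Thm 3 p.264 with (1.22) p.264 and §5 p.298] -/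
theorem runRem_bstar_of_moduli_NE4 (hL : HistLipschitz Λ γ β) (hΛ : FadingMemory C θ Λ) (hS : ScaleShiftRate c θ γ β)
    (hθ0 : 0 ≤ θ) (hθ1 : θ < 1) (hC : 0 ≤ C) {bstar : ℝ}
    (hb : ∀ u : ℝ, 0 < u → u ≤ γ → |betaInf β (fun _ : ℕ => u) - bstar| ≤ C * u / (1 - θ))
    {γ₀ : ℝ} (hγ₀ : 0 < γ₀) (hγ₀γ : γ₀ ≤ γ) :
    ∀ (n : ℕ) (gs : ℕ → ℝ), RGEqH n β gs → Step.InInterval γ₀ n gs →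
      ∀ k, k ≤ n → |β k (prefixOf gs k) - bstar| ≤ 2 * C * γ₀ / (1 - θ) + c / (1 - θ) := by
  intro _ gs _ hI k hk
  have h := abs_beta_sub_bstar_le hL hΛ hS hθ0 hθ1 hC hb hγ₀ hγ₀γ (prefixOf_mem_box hk hI)
  have h1θ : 0 < 1 - θ := by linarith
  have hc : 0 ≤ c := constant_nonneg_of_scaleShiftRate hS (hγ₀.trans_le hγ₀γ)
  have hθk : θ ^ k ≤ 1 := pow_le_one₀ hθ0 hθ1.le
  have hck : c * θ ^ k ≤ c := by nlinarith
  have hdiv : c * θ ^ k / (1 - θ) ≤ c / (1 - θ) := div_le_div_of_nonneg_right hck h1θ.le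
  linarith

/-- **UNDER NE4 THE CONSTANT-HISTORY VALUES ARE A DRIFTING ONE-LOOP SEQUENCE.**  `ScaleShiftRate c θ γ β` (0 ≤ θ < 1) and `0 < γ₀ ≤ γ` ⟹
`OneLoopDrift (betaInf β (γ₀,γ₀,…)) (c∕(1−θ)²) (k ↦ β_{k+1}(γ₀,…,γ₀))`: the partial sums of the β's own constant-history values stay within `c∕(1−θ)²` of the straight line of slope
`betaInf β (γ₀,γ₀,…)` (NE4's geometric tail `abs_const_sub_betaInf_le` summed).  With row (i) of `runRem_constHist_of_moduli` this is exactly the input of DEF-1's ★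
`…K2NamedJetsRunRemAt.endpointExistence_of_drift_runConstRemainder_survCont`, whose cap `r ≤ s` reads `Cγ₀∕(1−θ) ≤ betaInf β (γ₀,…)` — free on small levels once `b⋆ > 0`.
[cite: Balaban1987RG1, (1.3) p.260 and (1.22) p.264; King1986, Thm 3.4 (3.9) p.656 (shape of NE4)] -/
theorem oneLoopDrift_constHist_of_NE4 (hS : ScaleShiftRate c θ γ β) (hθ0 : 0 ≤ θ) (hθ1 : θ < 1) {γ₀ : ℝ} (hγ₀ : 0 < γ₀) (hγ₀γ : γ₀ ≤ γ) :
    OneLoopDrift (betaInf β (fun _ : ℕ => γ₀)) (c / (1 - θ) ^ 2) (fun k => β k (fun _ : Fin (k + 1) => γ₀)) := by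
  intro k
  have h1θ : 0 < 1 - θ := by linarith
  have hc : 0 ≤ c := constant_nonneg_of_scaleShiftRate hS (hγ₀.trans_le hγ₀γ)
  have hterm : ∀ j ∈ range k,
      |β j (fun _ : Fin (j + 1) => γ₀) - betaInf β (fun _ : ℕ => γ₀)| ≤ c * θ ^ j / (1 - θ) :=
    fun j _ => abs_const_sub_betaInf_le hS hθ1 hγ₀ hγ₀γ j
  have hsum : ∑ j ∈ range k, β j (fun _ : Fin (j + 1) => γ₀) - betaInf β (fun _ : ℕ => γ₀) * k =
      ∑ j ∈ range k, (β j (fun _ : Fin (j + 1) => γ₀) - betaInf β (fun _ : ℕ => γ₀)) := by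
    rw [sum_sub_distrib, sum_const, card_range, nsmul_eq_mul]; ring
  have hgeom : ∑ j ∈ range k, θ ^ j ≤ 1 / (1 - θ) := by
    have hg := geom_sum_Ico_le_of_lt_one (m := 0) (n := k) hθ0 hθ1
    rw [pow_zero] at hg
    rw [range_eq_Ico]; exact hg
  rw [hsum]
  calc |∑ j ∈ range k, (β j (fun _ : Fin (j + 1) => γ₀) - betaInf β (fun _ : ℕ => γ₀))|
        ≤ ∑ j ∈ range k, |β j (fun _ : Fin (j + 1) => γ₀) - betaInf β (fun _ : ℕ => γ₀)| := abs_sum_le_sum_abs _ _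
    _ ≤ ∑ j ∈ range k, c * θ ^ j / (1 - θ) := sum_le_sum hterm
    _ = c / (1 - θ) * ∑ j ∈ range k, θ ^ j := by rw [mul_sum]; exact sum_congr rfl fun j _ => by ring
    _ ≤ c / (1 - θ) * (1 / (1 - θ)) := mul_le_mul_of_nonneg_left hgeom (by positivity)
    _ = c / (1 - θ) ^ 2 := by rw [sq, div_mul_div_comm, mul_one]

/-! ## §2 Row (C): run-wise survivor continuity at every level from `HistLipschitz` alone -/

/-- Node U2's modulus on ]0, γ] gives (C) `BetaContH` on every smaller box (node U2's `betaContH_of_histLipschitz` restricted along `box_mono`). [folklore] -/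
theorem betaContH_of_moduli_le (hL : HistLipschitz Λ γ β) {γ₀ : ℝ} (hγ₀γ : γ₀ ≤ γ) : BetaContH γ₀ β :=
  fun k => (betaContH_of_histLipschitz hL k).mono (box_mono hγ₀γ k)

/-- **ROW (C) FROM node U2's MODULUS ALONE, AT EVERY LEVEL `0 < γ₀ ≤ γ`**: each trace `x ↦ β_{k+1}(clampPrefix β γ₀ k x)` is continuous on the survivor set of level `γ₀` at scale `k`
— DEF-1's `SurvCont β γ₀` spelled inline (pub-balaban-gaps' `survCont_of_betaContH` BY NAME on `betaContH_of_moduli_le`).  For Bałaban's β print ASSERTS smoothness in the last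
coupling only ([I] §1 pp. 263–264); the modulus in all couplings is NOT printed. [cite: Balaban1987RG1, §1 pp.263–264 and §5 p.298] -/
theorem survCont_of_moduli (hL : HistLipschitz Λ γ β) {γ₀ : ℝ} (hγ₀ : 0 < γ₀) (hγ₀γ : γ₀ ≤ γ) :
    ∀ k : ℕ, ContinuousOn (fun x : ℝ => β k (clampPrefix β γ₀ k x))
      {x : ℝ | 0 < x ∧ x ≤ γ₀ ∧ ∀ j, j ≤ k → 1 / γ₀ ^ 2 ≤ Y β γ₀ j x} :=
  survCont_of_betaContH hγ₀ (betaContH_of_moduli_le hL hγ₀γ)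

/-! ## §3 Row (iv): the run-wise partial-sum floor — three suppliers -/

/-- **(α) NE4-FREE: MODULI + A FAMILY OF (0.31)-RUNS ⟹ THE END-GRADE CARRIER ON THE SMALL BOX.**  Under the moduli on ]0, γ] and a displayed family of solutions of (0.20) in ]0, γ]
obeying the discrete two-sided (0.31) with slopes `0 < s ≤ s′` relative to their own endpoints (one per depth — the TYPED Theorem 2 at ONE endpoint), on every level `0 < γ₀ ≤ γ` with
`4Cγ₀ ≤ s(1−θ)`: `BetaPartialSumsLowerH D γ₀ β` with `D = 4C²∕((1−θ)²s²) + Cγθ∕(1−θ)²` (part 10's `betaAvgAFH_of_runs_fadingMemory`, slope `s∕4 ≥ 0`, crew CAP's `partialSums`).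
[cite: Balaban1987RG1, Thm 2 (0.31) p.259 with (0.20) p.256 and §5 p.298] -/
theorem betaPartialSumsLowerH_of_runs_moduli (hL : HistLipschitz Λ γ β) (hΛ : FadingMemory C θ Λ) (hθ0 : 0 ≤ θ) (hθ1 : θ < 1) (hC : 0 ≤ C)
    {γ₀ s s' : ℝ} (hγ₀ : 0 < γ₀) (hγ₀γ : γ₀ ≤ γ) (hs : 0 < s) (hsmall : 4 * C * γ₀ ≤ s * (1 - θ))
    (hruns : ∀ K : ℕ, ∃ r : ℕ → ℝ, RGEqH K β r ∧ Step.InInterval γ K r ∧ Step.Discrete031 s s' K (r K) r) :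
    BetaPartialSumsLowerH (4 * C ^ 2 / ((1 - θ) ^ 2 * s ^ 2) + C * γ * θ / (1 - θ) ^ 2) γ₀ β :=
  (betaAvgAFH_of_runs_fadingMemory hL hΛ hθ0 hθ1 hC hγ₀ hγ₀γ hs hsmall hruns).partialSums (by positivity)

/-- **(α) AS ROW (iv)**, NE4-free: the run-wise partial-sum floor `−D` along every in-window run of the level of `betaPartialSumsLowerH_of_runs_moduli` (pub-balaban-gaps'
`runwisePS_of_betaPartialSumsLowerH` BY NAME). [cite: Balaban1987RG1, Thm 2 (0.31) p.259 with (0.20) p.256] -/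
theorem runPS_of_runs_moduli (hL : HistLipschitz Λ γ β) (hΛ : FadingMemory C θ Λ) (hθ0 : 0 ≤ θ) (hθ1 : θ < 1) (hC : 0 ≤ C)
    {γ₀ s s' : ℝ} (hγ₀ : 0 < γ₀) (hγ₀γ : γ₀ ≤ γ) (hs : 0 < s) (hsmall : 4 * C * γ₀ ≤ s * (1 - θ))
    (hruns : ∀ K : ℕ, ∃ r : ℕ → ℝ, RGEqH K β r ∧ Step.InInterval γ K r ∧ Step.Discrete031 s s' K (r K) r) :
    ∀ (n : ℕ) (gs : ℕ → ℝ), RGEqH n β gs → Step.InInterval γ₀ n gs →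
      ∀ k, k ≤ n → -(4 * C ^ 2 / ((1 - θ) ^ 2 * s ^ 2) + C * γ * θ / (1 - θ) ^ 2) ≤ ∑ j ∈ Ico k n, β j (prefixOf gs j) :=
  runwisePS_of_betaPartialSumsLowerH hγ₀ (betaPartialSumsLowerH_of_runs_moduli hL hΛ hθ0 hθ1 hC hγ₀ hγ₀γ hs hsmall hruns)

/-- **(β) MODULI + NE4 ⟹ THE END-GRADE CARRIER WITH A LEVEL-FREE CONSTANT.**  Under the moduli + NE4 + `b⋆` (`hb`), on every level `0 < γ₀ ≤ γ` with `2Cγ₀ ≤ b⋆(1−θ)`: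
`BetaPartialSumsLowerH (c∕(1−θ)²) γ₀ β` — part 11h's carrier `betaAvgAFH_bstar` has slope `b⋆ − 2Cγ₀∕(1−θ) ≥ 0` there, so crew CAP's `partialSums` applies; the defect does NOT depend
on the level.  (The level condition forces `0 ≤ b⋆`; a positive level exists iff `b⋆ > 0` or `C = 0`.) [cite: Balaban1987RG1, Thm 2 p.259 and §5 p.298] -/
theorem betaPartialSumsLowerH_of_moduli_NE4 (hL : HistLipschitz Λ γ β) (hΛ : FadingMemory C θ Λ) (hS : ScaleShiftRate c θ γ β)
    (hθ0 : 0 ≤ θ) (hθ1 : θ < 1) (hC : 0 ≤ C) {bstar : ℝ}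
    (hb : ∀ u : ℝ, 0 < u → u ≤ γ → |betaInf β (fun _ : ℕ => u) - bstar| ≤ C * u / (1 - θ))
    {γ₀ : ℝ} (hγ₀ : 0 < γ₀) (hγ₀γ : γ₀ ≤ γ) (hsmall : 2 * C * γ₀ ≤ bstar * (1 - θ)) :
    BetaPartialSumsLowerH (c / (1 - θ) ^ 2) γ₀ β := by
  have h1θ : 0 < 1 - θ := by linarith
  refine (betaAvgAFH_bstar hL hΛ hS hθ0 hθ1 hC hb hγ₀ hγ₀γ).partialSums ?_
  rw [sub_nonneg, div_le_iff₀ h1θ]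
  linarith

/-- **(β) AS ROW (iv)**: under the moduli + NE4 + `b⋆`, along every in-window run of a level with `2Cγ₀ ≤ b⋆(1−θ)`, every window sum of the β's is `≥ −c∕(1−θ)²` — the SAME constant
at every such level. [cite: Balaban1987RG1, Thm 2 p.259 with (0.20) p.256 and §5 p.298] -/
theorem runPS_of_moduli_NE4 (hL : HistLipschitz Λ γ β) (hΛ : FadingMemory C θ Λ) (hS : ScaleShiftRate c θ γ β)
    (hθ0 : 0 ≤ θ) (hθ1 : θ < 1) (hC : 0 ≤ C) {bstar : ℝ}
    (hb : ∀ u : ℝ, 0 < u → u ≤ γ → |betaInf β (fun _ : ℕ => u) - bstar| ≤ C * u / (1 - θ))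
    {γ₀ : ℝ} (hγ₀ : 0 < γ₀) (hγ₀γ : γ₀ ≤ γ) (hsmall : 2 * C * γ₀ ≤ bstar * (1 - θ)) :
    ∀ (n : ℕ) (gs : ℕ → ℝ), RGEqH n β gs → Step.InInterval γ₀ n gs →
      ∀ k, k ≤ n → -(c / (1 - θ) ^ 2) ≤ ∑ j ∈ Ico k n, β j (prefixOf gs j) :=
  runwisePS_of_betaPartialSumsLowerH hγ₀ (betaPartialSumsLowerH_of_moduli_NE4 hL hΛ hS hθ0 hθ1 hC hb hγ₀ hγ₀γ hsmall)

/-- **(γ) node U2's EVENTUAL LETTER ⟹ THE END-GRADE CARRIER.**  `EventualLowerH b γ₀ k₀ β` with `0 ≤ b` and a displayed floor `−B ≤ β_{j+1}` on the boxes of the first `k₀` scales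
(`0 ≤ B`) ⟹ `BetaPartialSumsLowerH (k₀B) γ₀ β`: a window meets at most `k₀` floor-less scales, each costing at most `B`; from scale `k₀` on the terms are `≥ b ≥ 0`.
[cite: Balaban1987RG1, Thm 2 p.259 and §1 p.264] -/
theorem betaPartialSumsLowerH_of_eventualLowerH {b γ₀ B : ℝ} {k₀ : ℕ} (hE : EventualLowerH b γ₀ k₀ β) (hb : 0 ≤ b) (hB : 0 ≤ B)
    (hfirst : ∀ (j : ℕ) (v : Fin (j + 1) → ℝ), j < k₀ → v ∈ Box γ₀ j → -B ≤ β j v) :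
    BetaPartialSumsLowerH (k₀ * B) γ₀ β := by
  intro g hg k n _
  have hv : ∀ j, prefixOf g j ∈ Box γ₀ j := fun j => mem_box.mpr fun i => hg i
  have hterm : ∀ j ∈ Ico k n, (if j < k₀ then -B else (0 : ℝ)) ≤ β j (prefixOf g j) := by
    intro j _
    split_ifs with hj
    · exact hfirst j _ hj (hv j)
    · exact hb.trans (hE j _ (not_lt.mp hj) (hv j))
  have h1 : ∑ j ∈ Ico k n, (if j < k₀ then -B else (0 : ℝ)) ≤ ∑ j ∈ Ico k n, β j (prefixOf g j) := sum_le_sum hterm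
  have hsub : (Ico k n).filter (fun j => j < k₀) ⊆ range k₀ := fun j hj => mem_range.mpr (mem_filter.mp hj).2
  have hcard : (((Ico k n).filter (fun j => j < k₀)).card : ℝ) ≤ k₀ := by
    exact_mod_cast (card_le_card hsub).trans (card_range k₀).le
  have h2 : -((k₀ : ℝ) * B) ≤ ∑ j ∈ Ico k n, (if j < k₀ then -B else (0 : ℝ)) := by
    rw [sum_ite, sum_const_zero, add_zero, sum_const, smul_neg, nsmul_eq_mul]
    nlinarith
  linarith

/-! ## §4 THE ROWS TRIPLE — K1⁸'s ∃-shape `∃ b r γ₀ M, 0 < γ₀ ∧ (i) ∧ (iv) ∧ (C)` over an abstract β, anchor-free -/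

/-- **THE ROWS TRIPLE, NE4-FREE: MODULI + A FAMILY OF (0.31)-RUNS AT A POSITIVE SLOPE.**  `HistLipschitz Λ γ β` + `FadingMemory C θ Λ` (0 ≤ θ < 1, 0 ≤ C, 0 < γ) + a displayed family of
(0.31)-runs in ]0, γ] at slopes `0 < s ≤ s′` (one per depth) ⟹ `∃ b r γ₀ M, 0 < γ₀ ≤ γ ∧ (i) ∧ (iv) ∧ (C)` in the EXACT inline shape of the deciding crux K1⁸'s rows conjunct (DEF-1's
`RunRowsCont13`, over an abstract β): `γ₀ := min(γ, s(1−θ)∕(4(C+1)))`, `b k := β_{k+1}(γ₀,…,γ₀)`, `r := Cγ₀∕(1−θ)`, `M :=` (α)'s defect.  No anchor, no named jets, no drift, no cap, no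
ceiling; NE4 not used. [cite: Balaban1987RG1, Thm 2 (0.31) p.259, Thm 3 p.264, §1 pp.263–264, (5.10) p.293] -/
theorem rowsTriple_of_runs_moduli (hL : HistLipschitz Λ γ β) (hΛ : FadingMemory C θ Λ) (hθ0 : 0 ≤ θ) (hθ1 : θ < 1) (hC : 0 ≤ C)
    (hγ : 0 < γ) {s s' : ℝ} (hs : 0 < s)
    (hruns : ∀ K : ℕ, ∃ r : ℕ → ℝ, RGEqH K β r ∧ Step.InInterval γ K r ∧ Step.Discrete031 s s' K (r K) r) :
    ∃ (b : ℕ → ℝ) (r γ₀ M : ℝ), 0 < γ₀ ∧ γ₀ ≤ γ ∧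
      (∀ (n : ℕ) (gs : ℕ → ℝ), RGEqH n β gs → Step.InInterval γ₀ n gs → ∀ k, k ≤ n → |β k (prefixOf gs k) - b k| ≤ r) ∧
      (∀ (n : ℕ) (gs : ℕ → ℝ), RGEqH n β gs → Step.InInterval γ₀ n gs →
        ∀ k, k ≤ n → -M ≤ ∑ j ∈ Ico k n, β j (prefixOf gs j)) ∧
      ∀ k : ℕ, ContinuousOn (fun x : ℝ => β k (clampPrefix β γ₀ k x))
        {x : ℝ | 0 < x ∧ x ≤ γ₀ ∧ ∀ j, j ≤ k → 1 / γ₀ ^ 2 ≤ Y β γ₀ j x} := by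
  have h1θ : 0 < 1 - θ := by linarith
  set γ₀ : ℝ := min γ (s * (1 - θ) / (4 * (C + 1))) with hγ₀def
  have hγ₀ : 0 < γ₀ := lt_min hγ (by positivity)
  have hγ₀γ : γ₀ ≤ γ := min_le_left _ _
  have hsmall : 4 * C * γ₀ ≤ s * (1 - θ) := by
    have h1 : γ₀ ≤ s * (1 - θ) / (4 * (C + 1)) := min_le_right _ _
    have h2 : γ₀ * (4 * (C + 1)) ≤ s * (1 - θ) := (le_div_iff₀ (by positivity)).mp h1
    nlinarith
  exact ⟨fun k => β k (fun _ : Fin (k + 1) => γ₀), C * γ₀ / (1 - θ), γ₀, _, hγ₀, hγ₀γ,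
    runRem_constHist_of_moduli hL hΛ hθ0 hθ1 hC hγ₀ hγ₀γ,
    runPS_of_runs_moduli hL hΛ hθ0 hθ1 hC hγ₀ hγ₀γ hs hsmall hruns,
    survCont_of_moduli hL hγ₀ hγ₀γ⟩

/-- **THE THREE ROWS AT EVERY SMALL LEVEL WITH THE CONSTANT REMAINDER SEQUENCE `b ≡ b⋆`.**  Under the moduli + NE4 + `b⋆` (`hb`), at EVERY level `0 < γ₀ ≤ γ` with `2Cγ₀ ≤ b⋆(1−θ)`:
(i) with `b ≡ b⋆`, `r = 2Cγ₀∕(1−θ) + c∕(1−θ)`; (iv) with the level-free `M = c∕(1−θ)²`; (C).  Level-resolved form (no ∃) of K1⁸'s rows shape over an abstract β.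
[cite: Balaban1987RG1, Thm 2 p.259, Thm 3 p.264, §1 pp.263–264, (5.10) p.293, §5 p.298] -/
theorem rows_at_level_of_moduli_NE4 (hL : HistLipschitz Λ γ β) (hΛ : FadingMemory C θ Λ) (hS : ScaleShiftRate c θ γ β)
    (hθ0 : 0 ≤ θ) (hθ1 : θ < 1) (hC : 0 ≤ C) {bstar : ℝ}
    (hb : ∀ u : ℝ, 0 < u → u ≤ γ → |betaInf β (fun _ : ℕ => u) - bstar| ≤ C * u / (1 - θ))
    {γ₀ : ℝ} (hγ₀ : 0 < γ₀) (hγ₀γ : γ₀ ≤ γ) (hsmall : 2 * C * γ₀ ≤ bstar * (1 - θ)) :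
    (∀ (n : ℕ) (gs : ℕ → ℝ), RGEqH n β gs → Step.InInterval γ₀ n gs →
        ∀ k, k ≤ n → |β k (prefixOf gs k) - bstar| ≤ 2 * C * γ₀ / (1 - θ) + c / (1 - θ)) ∧
      (∀ (n : ℕ) (gs : ℕ → ℝ), RGEqH n β gs → Step.InInterval γ₀ n gs →
        ∀ k, k ≤ n → -(c / (1 - θ) ^ 2) ≤ ∑ j ∈ Ico k n, β j (prefixOf gs j)) ∧
      ∀ k : ℕ, ContinuousOn (fun x : ℝ => β k (clampPrefix β γ₀ k x))
        {x : ℝ | 0 < x ∧ x ≤ γ₀ ∧ ∀ j, j ≤ k → 1 / γ₀ ^ 2 ≤ Y β γ₀ j x} :=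
  ⟨runRem_bstar_of_moduli_NE4 hL hΛ hS hθ0 hθ1 hC hb hγ₀ hγ₀γ,
    runPS_of_moduli_NE4 hL hΛ hS hθ0 hθ1 hC hb hγ₀ hγ₀γ hsmall, survCont_of_moduli hL hγ₀ hγ₀γ⟩

/-- **THE ROWS TRIPLE FROM THE MODULI + NE4 + `0 < b⋆`.**  A positive asymptotic constant puts a positive level under the smallness `2Cγ₀ ≤ b⋆(1−θ)`
(`γ₀ := min(γ, b⋆(1−θ)∕(2(C+1)))`), so the rows ∃-shape holds with the CONSTANT remainder sequence `b ≡ b⋆`, `r = 2Cγ₀∕(1−θ) + c∕(1−θ)`, `M = c∕(1−θ)²`.  Part 12c's witness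
(`…PointwiseFadingRunRowsWitness`) shows `0 < b⋆` cannot be weakened to `0 ≤ b⋆` here. [cite: Balaban1987RG1, Thm 2 p.259, Thm 3 p.264, §1 pp.263–264, (5.10) p.293, §5 p.298] -/
theorem rowsTriple_of_moduli_NE4_bstar_pos (hL : HistLipschitz Λ γ β) (hΛ : FadingMemory C θ Λ) (hS : ScaleShiftRate c θ γ β)
    (hθ0 : 0 ≤ θ) (hθ1 : θ < 1) (hC : 0 ≤ C) (hγ : 0 < γ) {bstar : ℝ}
    (hb : ∀ u : ℝ, 0 < u → u ≤ γ → |betaInf β (fun _ : ℕ => u) - bstar| ≤ C * u / (1 - θ)) (hpos : 0 < bstar) :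
    ∃ (b : ℕ → ℝ) (r γ₀ M : ℝ), 0 < γ₀ ∧ γ₀ ≤ γ ∧ (∀ k, b k = bstar) ∧
      (∀ (n : ℕ) (gs : ℕ → ℝ), RGEqH n β gs → Step.InInterval γ₀ n gs → ∀ k, k ≤ n → |β k (prefixOf gs k) - b k| ≤ r) ∧
      (∀ (n : ℕ) (gs : ℕ → ℝ), RGEqH n β gs → Step.InInterval γ₀ n gs →
        ∀ k, k ≤ n → -M ≤ ∑ j ∈ Ico k n, β j (prefixOf gs j)) ∧
      ∀ k : ℕ, ContinuousOn (fun x : ℝ => β k (clampPrefix β γ₀ k x))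
        {x : ℝ | 0 < x ∧ x ≤ γ₀ ∧ ∀ j, j ≤ k → 1 / γ₀ ^ 2 ≤ Y β γ₀ j x} := by
  have h1θ : 0 < 1 - θ := by linarith
  set γ₀ : ℝ := min γ (bstar * (1 - θ) / (2 * (C + 1))) with hγ₀def
  have hγ₀ : 0 < γ₀ := lt_min hγ (by positivity)
  have hγ₀γ : γ₀ ≤ γ := min_le_left _ _
  have hsmall : 2 * C * γ₀ ≤ bstar * (1 - θ) := by
    have h1 : γ₀ ≤ bstar * (1 - θ) / (2 * (C + 1)) := min_le_right _ _
    have h2 : γ₀ * (2 * (C + 1)) ≤ bstar * (1 - θ) := (le_div_iff₀ (by positivity)).mp h1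
    nlinarith
  obtain ⟨hi, hiv, hC'⟩ := rows_at_level_of_moduli_NE4 hL hΛ hS hθ0 hθ1 hC hb hγ₀ hγ₀γ hsmall
  exact ⟨fun _ => bstar, _, γ₀, _, hγ₀, hγ₀γ, fun _ => rfl, hi, hiv, hC'⟩

/-! ## §4′ The sign-free |β| box and END for any forward-generated construction, from the letters -/

/-- **THE 3ᴬ′-CLASS SIGN-FREE |β| BOX FROM THE LETTERS, AT EVERY LEVEL.**  Under the moduli + NE4 + `b⋆` (`hb`) and `0 < γ₀ ≤ γ`: `BetaLowerH (−β′) γ₀ β ∧ BetaUpperH β′ γ₀ β` with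
`β′ = |b⋆| + 2Cγ₀∕(1−θ) + c∕(1−θ)` (the sandwich at all scales, `θ^k ≤ 1`) — the letter SHAPE of K0⁷'s registered stub 3ᴬ′ ([I] Thm 2 ∕ §1 p. 264 «uniformly bounded», no sign) and, by
dag-n24-w1's `…K1RunRowsOfBoxAndPartialSums.runConstRemainder_of_boxBounds`, the cheapest supplier of row (i) (`b :≡ 0`, `r := β′`).  CONDITIONAL on the letters. [cite: Balaban1987RG1, Thm 2 p.259 and §1 p.264; §5 p.298] -/
theorem absBox_of_moduli_NE4 (hL : HistLipschitz Λ γ β) (hΛ : FadingMemory C θ Λ) (hS : ScaleShiftRate c θ γ β)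
    (hθ0 : 0 ≤ θ) (hθ1 : θ < 1) (hC : 0 ≤ C) {bstar : ℝ}
    (hb : ∀ u : ℝ, 0 < u → u ≤ γ → |betaInf β (fun _ : ℕ => u) - bstar| ≤ C * u / (1 - θ))
    {γ₀ : ℝ} (hγ₀ : 0 < γ₀) (hγ₀γ : γ₀ ≤ γ) :
    BetaLowerH (-(|bstar| + 2 * C * γ₀ / (1 - θ) + c / (1 - θ))) γ₀ β ∧ BetaUpperH (|bstar| + 2 * C * γ₀ / (1 - θ) + c / (1 - θ)) γ₀ β := by
  have h1θ : 0 < 1 - θ := by linarith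
  have hc : 0 ≤ c := constant_nonneg_of_scaleShiftRate hS (hγ₀.trans_le hγ₀γ)
  have key : ∀ (k : ℕ) (v : Fin (k + 1) → ℝ), v ∈ Box γ₀ k → |β k v - bstar| ≤ 2 * C * γ₀ / (1 - θ) + c / (1 - θ) := by
    intro k v hv
    have h := abs_beta_sub_bstar_le hL hΛ hS hθ0 hθ1 hC hb hγ₀ hγ₀γ hv
    have hθk : θ ^ k ≤ 1 := pow_le_one₀ hθ0 hθ1.le
    have hck : c * θ ^ k ≤ c := by nlinarith
    have hdiv : c * θ ^ k / (1 - θ) ≤ c / (1 - θ) := div_le_div_of_nonneg_right hck h1θ.le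
    linarith
  refine ⟨fun k v hv => ?_, fun k v hv => ?_⟩
  · have h := (abs_le.mp (key k v hv)).1
    have hb' : -|bstar| ≤ bstar := neg_abs_le bstar
    linarith
  · have h := (abs_le.mp (key k v hv)).2
    have hb' : bstar ≤ |bstar| := le_abs_self bstar
    linarith

/-- **END FOR ANY FORWARD-GENERATED CONSTRUCTION CURRYING β, FROM THE LETTERS** (pub-balaban-gaps' `EndRunwiseShooting.endpointExistence_of_runwisePS` BY NAME): (C) from the modulus
(`betaContH_of_moduli_le`), (U) from `absBox_of_moduli_NE4`, the run-wise floor from `runPS_of_moduli_NE4` on a level with `2Cγ₀ ≤ b⋆(1−θ)`.  The YangMills-side companion reaches the same END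
through DEF-1's ★ (drift + remainder + cap) — two roads, by name.  CONDITIONAL on the letters; nothing closed. [cite: Balaban1987RG1, Thm 2 p.259 (first sentence), Thm 3 p.264, §1 pp.263–264, (5.10) p.293] -/
theorem endpointExistence_of_moduli_NE4 {Cn : B12.Construction} (hgen : ForwardGenerated Cn β)
    (hL : HistLipschitz Λ γ β) (hΛ : FadingMemory C θ Λ) (hS : ScaleShiftRate c θ γ β)
    (hθ0 : 0 ≤ θ) (hθ1 : θ < 1) (hC : 0 ≤ C) {bstar : ℝ}
    (hb : ∀ u : ℝ, 0 < u → u ≤ γ → |betaInf β (fun _ : ℕ => u) - bstar| ≤ C * u / (1 - θ))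
    {γ₀ : ℝ} (hγ₀ : 0 < γ₀) (hγ₀γ : γ₀ ≤ γ) (hsmall : 2 * C * γ₀ ≤ bstar * (1 - θ)) : EndpointExistence Cn := by
  have h1θ : 0 < 1 - θ := by linarith
  have hc : 0 ≤ c := constant_nonneg_of_scaleShiftRate hS (hγ₀.trans_le hγ₀γ)
  obtain ⟨-, hhi⟩ := absBox_of_moduli_NE4 hL hΛ hS hθ0 hθ1 hC hb hγ₀ hγ₀γ
  exact endpointExistence_of_runwisePS hgen hγ₀ (by positivity) (by positivity) (betaContH_of_moduli_le hL hγ₀γ) hhi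
    (runPS_of_moduli_NE4 hL hΛ hS hθ0 hθ1 hC hb hγ₀ hγ₀γ hsmall)

end Generic

/-! ## §5 On the as-printed carrier: [I] Theorem 2 AS TYPED + `hrg` + node U2's moduli ⟹ the rows ∃-shape for `S.β` -/

section AsPrinted

variable {S : Setting}

/-- **[I] THEOREM 2 AS TYPED + `hrg` + node U2's MODULI ⟹ THE DECIDING CRUX'S ROWS SHAPE FOR `S.β`, NE4-FREE.**  `Theorem2Statement S hL` (the statement-exact typing, a
HYPOTHESIS) + prover 1's binder `hrg` on ]0, γ_U] + `HistLipschitz Λ γ_U S.β` with `FadingMemory C θ Λ` (0 ≤ θ < 1, 0 ≤ C) ⟹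
`∃ b r γ₀ M, 0 < γ₀ ≤ γ_U ∧ (i) ∧ (iv) ∧ (C)` for `S.β` in the exact inline shape of `RunRowsCont13` — the typed theorem supplies the (0.31)-run family at ONE endpoint (part 10's
`runs_of_theorem2`), the moduli do the rest (`rowsTriple_of_runs_moduli`).  ANCHOR-FREE, JET-FREE, DRIFT-FREE, CAP-FREE, NE4-FREE; CONDITIONAL on the displayed letters; nothing of
Bałaban's β is asserted. [cite: Balaban1987RG1, Thm 2 (0.31) p.259, Thm 3 p.264, §1 pp.263–264, (5.10) p.293, §5 p.298] -/
theorem rowsTriple_of_typedTheorem2_fadingMemory {hL : Odd S.L ∧ 1 < S.L} (hT : Theorem2Statement S hL)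
    {γU C θ : ℝ} {Λ : ℕ → ℕ → ℝ} (hγU : 0 < γU) (hθ0 : 0 ≤ θ) (hθ1 : θ < 1) (hC : 0 ≤ C)
    (hrg : ∀ P : B12.RunParams, Step.InInterval γU P.K (S.cpl P) → RGEqH P.K S.β (S.cpl P))
    (hLip : HistLipschitz Λ γU S.β) (hΛ : FadingMemory C θ Λ) :
    ∃ (b : ℕ → ℝ) (r γ₀ M : ℝ), 0 < γ₀ ∧ γ₀ ≤ γU ∧
      (∀ (n : ℕ) (gs : ℕ → ℝ), RGEqH n S.β gs → Step.InInterval γ₀ n gs → ∀ k, k ≤ n → |S.β k (prefixOf gs k) - b k| ≤ r) ∧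
      (∀ (n : ℕ) (gs : ℕ → ℝ), RGEqH n S.β gs → Step.InInterval γ₀ n gs →
        ∀ k, k ≤ n → -M ≤ ∑ j ∈ Ico k n, S.β j (prefixOf gs j)) ∧
      ∀ k : ℕ, ContinuousOn (fun x : ℝ => S.β k (clampPrefix S.β γ₀ k x))
        {x : ℝ | 0 < x ∧ x ≤ γ₀ ∧ ∀ j, j ≤ k → 1 / γ₀ ^ 2 ≤ Y S.β γ₀ j x} := by
  obtain ⟨s, s', hs, -, hruns⟩ := runs_of_theorem2 hT hγU hrg
  exact rowsTriple_of_runs_moduli hLip hΛ hθ0 hθ1 hC hγU hs hruns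

/-- **WITH NE4: THE SAME ROWS WITH THE CONSTANT REMAINDER SEQUENCE `b ≡ b⋆ > 0`.**  `Theorem2Statement S hL` + `hrg` + the moduli + `ScaleShiftRate c θ γ_U S.β` ⟹ there is a number
`b⋆ > 0` (part 11's asymptotic constant, with its displayed property; positive by `bstar_pos_of_typedTheorem2`) and a level `0 < γ₀ ≤ γ_U` at which (i) holds with `b ≡ b⋆` and
`r = 2Cγ₀∕(1−θ) + c∕(1−θ)`, (iv) with `M = c∕(1−θ)²`, and (C). [cite: Balaban1987RG1, Thm 2 (0.31) p.259, Thm 3 p.264, §1 pp.263–264, (5.10) p.293, §5 p.298] -/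
theorem rowsTriple_of_typedTheorem2_NE4 {hL : Odd S.L ∧ 1 < S.L} (hT : Theorem2Statement S hL)
    {γU C c θ : ℝ} {Λ : ℕ → ℕ → ℝ} (hγU : 0 < γU) (hθ0 : 0 ≤ θ) (hθ1 : θ < 1) (hC : 0 ≤ C)
    (hrg : ∀ P : B12.RunParams, Step.InInterval γU P.K (S.cpl P) → RGEqH P.K S.β (S.cpl P))
    (hLip : HistLipschitz Λ γU S.β) (hΛ : FadingMemory C θ Λ) (hS : ScaleShiftRate c θ γU S.β) :
    ∃ bstar : ℝ, 0 < bstar ∧ (∀ u : ℝ, 0 < u → u ≤ γU → |betaInf S.β (fun _ : ℕ => u) - bstar| ≤ C * u / (1 - θ)) ∧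
      ∃ γ₀ : ℝ, 0 < γ₀ ∧ γ₀ ≤ γU ∧
        (∀ (n : ℕ) (gs : ℕ → ℝ), RGEqH n S.β gs → Step.InInterval γ₀ n gs →
          ∀ k, k ≤ n → |S.β k (prefixOf gs k) - bstar| ≤ 2 * C * γ₀ / (1 - θ) + c / (1 - θ)) ∧
        (∀ (n : ℕ) (gs : ℕ → ℝ), RGEqH n S.β gs → Step.InInterval γ₀ n gs →
          ∀ k, k ≤ n → -(c / (1 - θ) ^ 2) ≤ ∑ j ∈ Ico k n, S.β j (prefixOf gs j)) ∧
        ∀ k : ℕ, ContinuousOn (fun x : ℝ => S.β k (clampPrefix S.β γ₀ k x))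
          {x : ℝ | 0 < x ∧ x ≤ γ₀ ∧ ∀ j, j ≤ k → 1 / γ₀ ^ 2 ≤ Y S.β γ₀ j x} := by
  have h1θ : 0 < 1 - θ := by linarith
  obtain ⟨bstar, hb⟩ := exists_bstar hLip hΛ hS hθ0 hθ1 hC hγU
  have hpos : 0 < bstar := bstar_pos_of_typedTheorem2 hT hγU hθ0 hθ1 hC hrg hLip hΛ hS hb
  set γ₀ : ℝ := min γU (bstar * (1 - θ) / (2 * (C + 1))) with hγ₀def
  have hγ₀ : 0 < γ₀ := lt_min hγU (by positivity)
  have hγ₀γ : γ₀ ≤ γU := min_le_left _ _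
  have hsmall : 2 * C * γ₀ ≤ bstar * (1 - θ) := by
    have h1 : γ₀ ≤ bstar * (1 - θ) / (2 * (C + 1)) := min_le_right _ _
    have h2 : γ₀ * (2 * (C + 1)) ≤ bstar * (1 - θ) := (le_div_iff₀ (by positivity)).mp h1
    nlinarith
  exact ⟨bstar, hpos, hb, γ₀, hγ₀, hγ₀γ, rows_at_level_of_moduli_NE4 hLip hΛ hS hθ0 hθ1 hC hb hγ₀ hγ₀γ hsmall⟩

end AsPrinted

end

end Summit.QuantumFields.BalabanUV.Beta.EriceFlowEnclosureB12AsPrintedPointwiseFadingRunRows
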